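import Summits.Ventures.CertifiedArithmetic.LowPrec.GemmBeyondHalfUlp

/-!
# Truncation with a growing middle run: the last certified regime of `E2M1² → bfloat16` under `RZ`

HONEST FRAMING (venture CertifiedArithmetic / cell `pub-lowprec`): certified error envelopes and
provably optimal rounding/accumulation schemes for low-precision formats under stated cost models;
every table by two implementations; no hardware or vendor claims.

For `E2M1 × E2M1` products accumulated sequentially in `bfloat16` with `roundTowardZero`, the
two-implementation certificate rows give `W(n) = (3n - 13)/(3n + 499)` on `26 ≤ n ≤ 166` (the
stationary truncation chain `bf16_rz128`, file `GemmDirectedChains`), an irregular stretch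
`167..316`, and `W(n) = (3n - 549)/(3n - 389)` on `317 ≤ n ≤ 512`. The optimal inputs of the last
regime are NOT prefixes of one infinite sequence: the input of length `n = 317 + j` is
`(-36)^×60, -24, (-12)^×j, (1/4)^×256` — the run that grows with `n` sits in the MIDDLE. This file
kernel-checks that two-parameter family (`rzMid j`): sixty letters `-36` drive the accumulator to
`-2032` (exact until `-1008`, then each addition truncates `4` toward zero), `-24 ↦ -2048`; at
`-2048` (ulp `16`) the letter `-12` is truncated away ENTIRELY (`-2060 ↦ -2048`), so each of the `j`
middle letters adds `12` to both the error and `Σ|xᵢ|`; finally `256` letters `1/4` pull the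
accumulator toward zero by a full ulp each (`8` down to `-1024`, then `4`) to `-512` while the
exact sum moves by `64` only. Error `1608 + 12j`, `Σ|xᵢ| = 2248 + 12j`, ratio
`(3n - 549)/(3n - 389)` for every `n ≥ 317` (`rzMid_ratio`); values `201/281` (`n = 317`) and
`987/1147` (`n = 512`). Lower bounds only — optimality on `317..512` is the certificate's business
[cite: BoldoEtAl2023, Thm. 4.5] [cite: LangeRump2018]. New generic piece: `seqSumWith_congr`
(the recursive sum up to `m` depends only on the letters `≤ m`), used to evaluate the common
prefix of a parametrised family by `decide`.
-/

namespace Literature.ComputerArithmetic.FloatingPoint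

namespace MiniFloat

open Finset

variable {α : Format}

namespace TZChain

open Format TieChain

/-- `seqSumWith r x m` depends only on `x 0, …, x m`. [folklore] -/
theorem seqSumWith_congr (r : ℚ → MiniFloat α) (x y : ℕ → ℚ) (m : ℕ) (h : ∀ k ≤ m, x k = y k) :
    seqSumWith r x m = seqSumWith r y m := by
  induction m with
  | zero =>
      show r (x 0) = r (y 0)
      rw [h 0 le_rfl]
  | succ m ih =>
      show r ((seqSumWith r x m).toRat + x (m + 1)) = r ((seqSumWith r y m).toRat + y (m + 1))
      rw [ih (fun k hk => h k (by omega)), h (m + 1) le_rfl]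

/-! ### The family `rzMid j = ((-36)^×60, -24, (-12)^×j, (1/4)^×256, 1/4, …)` -/

/-- The member of index `j` (input length `n = 317 + j`). [folklore] -/
def rzMid (j : ℕ) : ℕ → ℚ := fun k =>
  if k < 60 then -36 else if k = 60 then -24 else if k ≤ 60 + j then -12 else 1 / 4

/-- The common prefix as a closed function (tail `0`, never read). [folklore] -/
def rzMidPre : ℕ → ℚ := fun k => if k < 60 then -36 else if k = 60 then -24 else 0

/-- The pull-back trajectory: `-2048 + 8i` for `i ≤ 128`, then `-1536 + 4i` up to `i = 256`.
[folklore] -/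
def vMid : ℕ → ℚ := fun i => if i ≤ 128 then -2048 + 8 * (i : ℚ) else -1536 + 4 * (i : ℚ)

/-- Every letter is a product of two `E2M1` data: `-36 = (-6)·6`, `-24 = (-6)·4`, `-12 = (-6)·2`,
`1/4 = ½·½`. [folklore] -/
theorem rzMid_letters (j k : ℕ) : ∃ a b : MiniFloat E2M1, a.toRat * b.toRat = rzMid j k := by
  unfold rzMid
  split_ifs
  · exact ⟨⟨true, 3, 1, by decide, by decide, by decide⟩,
      ⟨false, 3, 1, by decide, by decide, by decide⟩, by decide +kernel⟩
  · exact ⟨⟨true, 3, 1, by decide, by decide, by decide⟩,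
      ⟨false, 3, 0, by decide, by decide, by decide⟩, by decide +kernel⟩
  · exact ⟨⟨true, 3, 1, by decide, by decide, by decide⟩,
      ⟨false, 2, 0, by decide, by decide, by decide⟩, by decide +kernel⟩
  · exact ⟨⟨false, 0, 1, by decide, by decide, by decide⟩,
      ⟨false, 0, 1, by decide, by decide, by decide⟩, by decide +kernel⟩

/-- On indices `≤ 60` every member agrees with the closed prefix. [folklore] -/
theorem rzMid_prefix (j k : ℕ) (hk : k ≤ 60) : rzMid j k = rzMidPre k := by
  unfold rzMid rzMidPre
  split_ifs <;> first | rfl | omega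

/-- The middle run: letters `61 … 60 + j` are `-12`. [folklore] -/
theorem rzMid_mid (j k : ℕ) (h1 : 60 < k) (h2 : k ≤ 60 + j) : rzMid j k = -12 := by
  unfold rzMid
  split_ifs <;> first | rfl | omega

/-- After the middle run every letter is `1/4`. [folklore] -/
theorem rzMid_suffix (j k : ℕ) (h : 60 + j < k) : rzMid j k = 1 / 4 := by
  unfold rzMid
  split_ifs <;> first | rfl | omega

/-- Phase 1 (common prefix): `ŝ₆₀ = -2048`. [folklore] -/
theorem rzMid_s60 (j : ℕ) : (seqSumWith (roundTowardZero BFloat16) (rzMid j) 60).toRat = -2048 := by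
  rw [seqSumWith_congr _ (rzMid j) rzMidPre 60 (fun k hk => rzMid_prefix j k hk)]
  decide +kernel

/-- Phase 1 stays in range (a closed computation on the prefix). [folklore] -/
theorem rzMidPre_inRange : InRangeWith (roundTowardZero BFloat16) rzMidPre 60 := by
  unfold InRangeWith; decide +kernel

/-- Phase 2: at `-2048` the letter `-12` is truncated away — `ŝ_{60+i} = -2048` for `i ≤ j`.
[folklore] -/
theorem rzMid_flat (j : ℕ) :
    ∀ i ≤ j, (seqSumWith (roundTowardZero BFloat16) (rzMid j) (60 + i)).toRat = -2048 :=
  seqSumWith_orbit (roundTowardZero BFloat16) (rzMid j) 60 j (-12) (fun _ => -2048)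
    (fun i hi => rzMid_mid j _ (by omega) (by omega)) (rzMid_s60 j)
    (fun i hi => by
      show (roundTowardZero BFloat16 (-2048 + -12)).toRat = -2048
      decide +kernel)

/-- The `256` pull-back steps: `vMid i + 1/4` truncates toward zero to `vMid (i+1)`. [folklore] -/
theorem vMid_step : ∀ i < 256, (roundTowardZero BFloat16 (vMid i + 1 / 4)).toRat = vMid (i + 1) := by
  decide +kernel

/-- Phase 3: `ŝ_{60+j+i} = vMid i` for `i ≤ 256`; in particular `ŝ_{316+j} = -512`. [folklore] -/
theorem rzMid_pull (j : ℕ) :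
    ∀ i ≤ 256, (seqSumWith (roundTowardZero BFloat16) (rzMid j) (60 + j + i)).toRat = vMid i :=
  seqSumWith_orbit (roundTowardZero BFloat16) (rzMid j) (60 + j) 256 (1 / 4) vMid
    (fun i hi => rzMid_suffix j _ (by omega))
    (by rw [rzMid_flat j j le_rfl]; decide +kernel) vMid_step

/-- The final accumulator of the member of index `j`: `ŝ_{316+j} = -512`. [folklore] -/
theorem rzMid_last (j : ℕ) :
    (seqSumWith (roundTowardZero BFloat16) (rzMid j) (316 + j)).toRat = -512 := by
  have h := rzMid_pull j 256 le_rfl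
  rw [show 60 + j + 256 = 316 + j by omega] at h
  rw [h]; decide +kernel

/-- Bounds along the pull-back. [folklore] -/
theorem vMid_bounds (i : ℕ) (hi : i ≤ 256) : -2048 ≤ vMid i ∧ vMid i ≤ -512 := by
  have hiq : (i : ℚ) ≤ 256 := by exact_mod_cast hi
  unfold vMid
  split_ifs with h
  · have : (i : ℚ) ≤ 128 := by exact_mod_cast h
    constructor <;> linarith
  · have : (129 : ℚ) ≤ i := by exact_mod_cast (by omega : 129 ≤ i)
    constructor <;> linarith

/-- The member of index `j` stays in the finite range of `bfloat16` for all its `317 + j` letters.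
[folklore] -/
theorem rzMid_inRange (j : ℕ) : InRangeWith (roundTowardZero BFloat16) (rzMid j) (316 + j) := by
  have hM : (4096 : ℚ) ≤ BFloat16.maxRat := by decide +kernel
  refine ⟨by rw [rzMid_prefix j 0 (by omega)]; decide +kernel, fun k hk => ?_⟩
  by_cases h60 : k < 60
  · have h1 := rzMidPre_inRange.2 k h60
    rw [seqSumWith_congr _ (rzMid j) rzMidPre k (fun i hi => rzMid_prefix j i (by omega)),
      rzMid_prefix j (k + 1) (by omega)]
    exact h1
  by_cases hmid : k < 60 + j
  · obtain ⟨i, rfl⟩ : ∃ i, k = 60 + i := ⟨k - 60, by omega⟩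
    rw [rzMid_flat j i (by omega), rzMid_mid j _ (by omega) (by omega)]
    decide +kernel
  · obtain ⟨i, rfl⟩ : ∃ i, k = 60 + j + i := ⟨k - (60 + j), by omega⟩
    rw [rzMid_pull j i (by omega), rzMid_suffix j _ (by omega)]
    obtain ⟨h1, h2⟩ := vMid_bounds i (by omega)
    rw [abs_le]; constructor <;> linarith

/-- Exact sum of the member of index `j`: `-2120 - 12j`. [folklore] -/
theorem rzMid_sum (j : ℕ) : ∑ i ∈ range (317 + j), rzMid j i = -2120 - 12 * (j : ℚ) := by
  rw [show 317 + j = 61 + (j + 256) by omega, sum_range_add, sum_range_add]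
  have h1 : ∑ i ∈ range 61, rzMid j i = ∑ i ∈ range 61, rzMidPre i :=
    sum_congr rfl (fun i hi => rzMid_prefix j i (by simpa [Nat.lt_succ_iff] using mem_range.mp hi))
  have h2 : ∑ i ∈ range j, rzMid j (61 + i) = ∑ i ∈ range j, (-12 : ℚ) :=
    sum_congr rfl (fun i hi => rzMid_mid j _ (by omega) (by have := mem_range.mp hi; omega))
  have h3 : ∑ i ∈ range 256, rzMid j (61 + (j + i)) = ∑ i ∈ range 256, (1 / 4 : ℚ) :=
    sum_congr rfl (fun i hi => rzMid_suffix j _ (by omega))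
  rw [h1, h2, h3, (by decide +kernel : ∑ i ∈ range 61, rzMidPre i = -2184)]
  simp; ring

/-- Sum of magnitudes of the member of index `j`: `2248 + 12j`. [folklore] -/
theorem rzMid_absSum (j : ℕ) : ∑ i ∈ range (317 + j), |rzMid j i| = 2248 + 12 * (j : ℚ) := by
  rw [show 317 + j = 61 + (j + 256) by omega, sum_range_add, sum_range_add]
  have h1 : ∑ i ∈ range 61, |rzMid j i| = ∑ i ∈ range 61, |rzMidPre i| :=
    sum_congr rfl (fun i hi => by
      rw [rzMid_prefix j i (by simpa [Nat.lt_succ_iff] using mem_range.mp hi)])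
  have h2 : ∑ i ∈ range j, |rzMid j (61 + i)| = ∑ i ∈ range j, (12 : ℚ) :=
    sum_congr rfl (fun i hi => by
      rw [rzMid_mid j _ (by omega) (by have := mem_range.mp hi; omega)]; norm_num)
  have h3 : ∑ i ∈ range 256, |rzMid j (61 + (j + i))| = ∑ i ∈ range 256, (1 / 4 : ℚ) :=
    sum_congr rfl (fun i hi => by rw [rzMid_suffix j _ (by omega)]; norm_num)
  rw [h1, h2, h3, (by decide +kernel : ∑ i ∈ range 61, |rzMidPre i| = 2184)]
  simp; ring

/-- The ratio of the member of length `n` (index `j = n - 317`) for every `n ≥ 317`: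
`(3n - 549)/(3n - 389)`. [folklore] -/
theorem rzMid_ratio (n : ℕ) (hn : 317 ≤ n) :
    |(seqSumWith (roundTowardZero BFloat16) (rzMid (n - 317)) (n - 1)).toRat -
        ∑ i ∈ range n, rzMid (n - 317) i| / ∑ i ∈ range n, |rzMid (n - 317) i| =
      (3 * (n : ℚ) - 549) / (3 * n - 389) := by
  obtain ⟨j, rfl⟩ : ∃ j, n = 317 + j := ⟨n - 317, by omega⟩
  rw [Nat.add_sub_cancel_left, show 317 + j - 1 = 316 + j by omega, rzMid_last, rzMid_sum,
    rzMid_absSum]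
  have hj : (0 : ℚ) ≤ j := by positivity
  rw [abs_of_nonneg (by linarith), div_eq_div_iff (by positivity) (by push_cast; linarith)]
  push_cast; ring

/-- For every `n ≥ 317` the middle-run input beats the stationary truncation chain `bf16_rz128`
(`(3n - 13)/(3n + 499)`, optimal on `26..166`); as rational functions the crossover is `n = 265`.
[folklore] -/
theorem rzMid_exceeds_rz128 (n : ℕ) (hn : 190 ≤ n) :
    (3 * (n : ℚ) - 13) / (3 * n + 499) < (3 * (n : ℚ) - 549) / (3 * n - 389) ↔ 265 ≤ n := by
  have h0 : (190 : ℚ) ≤ n := by exact_mod_cast hn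
  rw [div_lt_div_iff₀ (by positivity) (by linarith)]
  constructor
  · intro h
    by_contra hc
    have : (n : ℚ) ≤ 264 := by exact_mod_cast (by omega : n ≤ 264)
    nlinarith
  · intro h
    have : (265 : ℚ) ≤ n := by exact_mod_cast h
    nlinarith

/-- Values at the ends of the certified range: `201/281` (`n = 317`), `987/1147` (`n = 512`).
[folklore] -/
theorem rzMid_values :
    (3 * (317 : ℚ) - 549) / (3 * 317 - 389) = 201 / 281 ∧
    (3 * (512 : ℚ) - 549) / (3 * 512 - 389) = 987 / 1147 := by norm_num

end TZChain

end MiniFloat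

end Literature.ComputerArithmetic.FloatingPoint
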